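import Summits.CriticalPhenomena.PercolationContinuityZ3.Theorems.PercNearOneGluingNoHeavyPcintWinKernelSymCert
import HarnessLib

/-!
# PCINT lane, kernel window certificates — certificate tables as binary search trees

Cell `prim-pcint`, seat `prim-pcint-2` (gen 2); memo `run/shared/lean/prim/pcint/EFFICIENCY.md` §4, INTERVAL-PLAN §15.
Does NOT build on p205010.  In the keyed row checks `WinK.rowOKBK` / `WinK.rowOKSK` (`…PcintWinKernelSymCert`) the
certificate value of a window is `lookupK tbl dflt u`: a LINEAR `List.find?` over the table, which the kernel walks at
≈ 80 μs per entry — for tables of 2000–8500 normal-form states this is 60–90 % of the cost of a Collatz–Wielandt row.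
Here the table is a binary search tree `WinK.KT` (`find` = `O(depth)` comparisons with `Nat.blt`), with
* `KT.find_eq_of_ordered`: on a tree whose keys are search-ordered (`KT.ordered`, a Boolean check) `find` agrees with
  `List.find?` on the in-order list `KT.toList`;
* `lookupT` / `rowOKBT` / `rowOKST`: the keyed value and the two row checks read from a tree, and `rowOKBT_eq` / `rowOKST_eq`:
  they coincide with `rowOKBK` / `rowOKSK` of the table `t.toList` — so instance files check rows on the tree
  (`decide +kernel`) and convert once (`all_rowOKBK_of_tree`, `all_rowOKSK_of_tree`) before applying
  `le_criticalProb_of_checkBK` / `le_siteCriticalProb_of_checkSK`;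
* `KT.ofListF fuel tbl`: a balanced tree built from the (key-sorted) table by halving; no correctness theorem is needed —
  an instance checks `(KT.ofListF F tbl).ordered` and `(KT.ofListF F tbl).toList = tbl` by `decide +kernel`.
-/

namespace Summit.CriticalPhenomena.PercolationContinuityZ3.Theorems.Pcint

open Finset

namespace WinK

/-- Binary search tree of `key ↦ value` pairs (certificate tables). [folklore] -/
inductive KT : Type where
  | leaf : KT
  | node : KT → ℕ → ℕ → KT → KT

namespace KT

/-- Search-tree lookup (two `Nat.blt` comparisons per visited node). [folklore] -/
def find (k : ℕ) : KT → Option ℕ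
  | leaf => none
  | node l key v r => bif Nat.blt k key then find k l else bif Nat.blt key k then find k r else some v

/-- In-order list of the tree. [folklore] -/
def toList : KT → List (ℕ × ℕ)
  | leaf => []
  | node l key v r => toList l ++ (key, v) :: toList r

/-- Every key of the tree satisfies a Boolean test. [folklore] -/
def allKeys (p : ℕ → Bool) : KT → Bool
  | leaf => true
  | node l key _ r => p key && allKeys p l && allKeys p r

/-- Search-tree invariant: at every node the left keys are smaller and the right keys larger. [folklore] -/
def ordered : KT → Bool
  | leaf => true
  | node l key _ r =>
    allKeys (fun k => Nat.blt k key) l && allKeys (fun k => Nat.blt key k) r && ordered l && ordered r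

/-- A balanced tree from a list, by repeated halving (`fuel` ≥ depth; for a key-sorted list with distinct keys the
result is `ordered` with `toList = ` the list — checked per instance by `decide`). [folklore] -/
def ofListF : ℕ → List (ℕ × ℕ) → KT
  | 0, _ => leaf
  | fuel + 1, l =>
    match l with
    | [] => leaf
    | _ :: _ =>
      node (ofListF fuel (l.take (l.length / 2))) (l.getD (l.length / 2) (0, 0)).1 (l.getD (l.length / 2) (0, 0)).2
        (ofListF fuel (l.drop (l.length / 2 + 1)))

/-- Keys listed in order satisfy the test of `allKeys`. [folklore] -/
theorem allKeys_toList {p : ℕ → Bool} : ∀ {t : KT}, allKeys p t = true → ∀ e ∈ toList t, p e.1 = true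
  | leaf, _, e, he => by simp [toList] at he
  | node l key v r, h, e, he => by
    simp only [allKeys, Bool.and_eq_true] at h
    obtain ⟨⟨hk, hl⟩, hr⟩ := h
    simp only [toList, List.mem_append, List.mem_cons] at he
    rcases he with he | he | he
    · exact allKeys_toList hl e he
    · subst he; exact hk
    · exact allKeys_toList hr e he

/-- **On an ordered tree, `find` is `List.find?` on the in-order list.** [folklore] -/
theorem find_eq_of_ordered : ∀ {t : KT}, ordered t = true → ∀ k : ℕ,
    find k t = ((toList t).find? fun e => e.1 = k).map fun e => e.2
  | leaf, _, k => by simp [find, toList]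
  | node l key v r, h, k => by
    simp only [ordered, Bool.and_eq_true] at h
    obtain ⟨⟨⟨hl, hr⟩, hol⟩, hor⟩ := h
    have hl' : ∀ e ∈ toList l, e.1 < key := fun e he => by
      simpa [Nat.blt_eq] using allKeys_toList hl e he
    have hr' : ∀ e ∈ toList r, key < e.1 := fun e he => by
      simpa [Nat.blt_eq] using allKeys_toList hr e he
    rw [toList, List.find?_append, find]
    by_cases h1 : k < key
    · have hb : Nat.blt k key = true := by simpa [Nat.blt_eq] using h1
      rw [hb, cond_true, find_eq_of_ordered hol k]
      have hn : (((key, v) :: toList r).find? fun e => e.1 = k) = none := by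
        rw [List.find?_eq_none]
        intro e he
        rcases List.mem_cons.mp he with rfl | he
        · simp only [decide_eq_true_eq]; omega
        · have := hr' e he; simp only [decide_eq_true_eq]; omega
      rw [hn, Option.or_none]
    · have hb : Nat.blt k key = false := Bool.eq_false_iff.mpr (by rw [Ne, Nat.blt_eq]; exact h1)
      rw [hb, cond_false]
      have hnone : ((toList l).find? fun e => e.1 = k) = none := by
        rw [List.find?_eq_none]
        intro e he
        have := hl' e he
        simp only [decide_eq_true_eq]; omega
      rw [hnone, Option.none_or]
      by_cases h2 : key < k
      · have hb2 : Nat.blt key k = true := by simpa [Nat.blt_eq] using h2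
        rw [hb2, cond_true, find_eq_of_ordered hor k, List.find?_cons_of_neg]
        simp only [decide_eq_true_eq]; omega
      · have hb2 : Nat.blt key k = false := Bool.eq_false_iff.mpr (by rw [Ne, Nat.blt_eq]; exact h2)
        have hk : key = k := by omega
        rw [hb2, cond_false, List.find?_cons_of_pos (by simp only [decide_eq_true_eq]; exact hk)]
        rfl

end KT

variable {d : ℕ}

/-- Certificate value of a window read from a search tree keyed by the Gram code. [folklore] -/
def lookupT {n : ℕ} (t : KT) (dflt : ℕ) (u : Fin n → Fin d × Bool) : ℕ := (t.find (gramCode u)).getD dflt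

/-- On an ordered tree listing `tbl`, the tree value is the table value `lookupK`. [folklore] -/
theorem lookupT_eq_lookupK {n : ℕ} {t : KT} {tbl : List (ℕ × ℕ)} (ho : t.ordered = true) (ht : t.toList = tbl)
    (dflt : ℕ) (u : Fin n → Fin d × Bool) : lookupT t dflt u = lookupK tbl dflt u := by
  rw [lookupT, lookupK, KT.find_eq_of_ordered ho, ht]

/-! ### Rows read from a tree -/

section Rows

variable (d m pn R S Q lamN : ℕ) (t : KT) (dflt : ℕ)

/-- Certificate value of an `(m+1)`-window from the tree. [folklore] -/
def vKT (u : Fin (m + 1) → Fin d × Bool) : ℕ := lookupT t dflt u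

/-- One summand of the scaled B3r row, values from the tree (cf. `rowTermBK`). [folklore] -/
def rowTermBT (u : Fin (m + 1) → Fin d × Bool) (a : Fin d × Bool) : ℕ :=
  let ps := sitesF u a
  if okcF ps then termB pn R S (m + 1) (2 * d) (ccF m ps) (gNF d m ps) (cNF d m ps a) * vKT d m t dflt (wshift u a) else 0

/-- One summand of the scaled B2r row, values from the tree (cf. `rowTermSK`). [folklore] -/
def rowTermST (u : Fin (m + 1) → Fin d × Bool) (a : Fin d × Bool) : ℕ :=
  let ps := sitesF u a
  if okNF m ps then termS pn Q (2 * d) (gNF d m ps) (cNF d m ps a) * vKT d m t dflt (wshift u a) else 0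

/-- Scaled B3r row, values from the tree. [folklore] -/
def rowBT (u : Fin (m + 1) → Fin d × Bool) : ℕ := ∑ a : Fin d × Bool, rowTermBT d m pn R S t dflt u a

/-- Scaled B2r row, values from the tree. [folklore] -/
def rowST (u : Fin (m + 1) → Fin d × Bool) : ℕ := ∑ a : Fin d × Bool, rowTermST d m pn Q t dflt u a

/-- B3r row check on one code, values from the tree (cf. `rowOKBK`). [folklore] -/
def rowOKBT [NeZero d] (c : ℕ) : Bool :=
  decide (10 ^ 5 * rowBT d m pn R S t dflt (decodeW d (m + 1) c) ≤ lamN * denB d m * vKT d m t dflt (decodeW d (m + 1) c))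

/-- B2r row check on one code, values from the tree (cf. `rowOKSK`). [folklore] -/
def rowOKST [NeZero d] (c : ℕ) : Bool :=
  decide (10 ^ 5 * rowST d m pn Q t dflt (decodeW d (m + 1) c) ≤ lamN * denS d * vKT d m t dflt (decodeW d (m + 1) c))

end Rows

/-- **Tree rows are table rows (B3r).** [folklore] -/
theorem rowOKBT_eq {d m pn R S lamN : ℕ} [NeZero d] {t : KT} {tbl : List (ℕ × ℕ)} {dflt : ℕ}
    (ho : t.ordered = true) (ht : t.toList = tbl) :
    rowOKBT d m pn R S lamN t dflt = rowOKBK d m pn R S lamN tbl dflt := by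
  funext c
  have hv : ∀ u : Fin (m + 1) → Fin d × Bool, vKT d m t dflt u = vK d m tbl dflt u :=
    fun u => lookupT_eq_lookupK ho ht dflt u
  simp only [rowOKBT, rowOKBK, rowBT, rowBK, rowTermBT, rowTermBK, hv]

/-- **Tree rows are table rows (B2r).** [folklore] -/
theorem rowOKST_eq {d m pn Q lamN : ℕ} [NeZero d] {t : KT} {tbl : List (ℕ × ℕ)} {dflt : ℕ}
    (ho : t.ordered = true) (ht : t.toList = tbl) :
    rowOKST d m pn Q lamN t dflt = rowOKSK d m pn Q lamN tbl dflt := by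
  funext c
  have hv : ∀ u : Fin (m + 1) → Fin d × Bool, vKT d m t dflt u = vK d m tbl dflt u :=
    fun u => lookupT_eq_lookupK ho ht dflt u
  simp only [rowOKST, rowOKSK, rowST, rowSK, rowTermST, rowTermSK, hv]

/-- A B3r row check on a list of codes, done on an ordered tree listing the table, is the table check. [folklore] -/
theorem all_rowOKBK_of_tree {d m pn R S lamN : ℕ} [NeZero d] {t : KT} {tbl : List (ℕ × ℕ)} {dflt : ℕ}
    (ho : t.ordered = true) (ht : t.toList = tbl) {l : List ℕ} (h : l.all (rowOKBT d m pn R S lamN t dflt) = true) :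
    l.all (rowOKBK d m pn R S lamN tbl dflt) = true := by
  rw [← rowOKBT_eq ho ht]; exact h

/-- A B2r row check on a list of codes, done on an ordered tree listing the table, is the table check. [folklore] -/
theorem all_rowOKSK_of_tree {d m pn Q lamN : ℕ} [NeZero d] {t : KT} {tbl : List (ℕ × ℕ)} {dflt : ℕ}
    (ho : t.ordered = true) (ht : t.toList = tbl) {l : List ℕ} (h : l.all (rowOKST d m pn Q lamN t dflt) = true) :
    l.all (rowOKSK d m pn Q lamN tbl dflt) = true := by
  rw [← rowOKST_eq ho ht]; exact h

end WinK

end Summit.CriticalPhenomena.PercolationContinuityZ3.Theorems.Pcint
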